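import Literature.NumberTheory.GaloisRepresentations.LubinTateColemanRelativeExactTwo
import Literature.NumberTheory.GaloisRepresentations.LubinTateColemanRelativeCoordKernelTwo
import HarnessLib

/-!
# Theorem I.3.7 over an unramified base `k' = E` at `q = 2` for de Shalit's PRINCIPAL units:
# `β ↦ r_β` is injective on `𝒰¹(E·K_π^∞)` with image `{r : r(0) ∈ (1 − u·φ)𝒪_E}`

De Shalit, *Iwasawa theory of elliptic curves with complex multiplication* (1987), Ch. I §3.3 (`𝒰 = lim← U(k_ξ^n)`, PRINCIPAL
units), §3.7 Theorem (`0 → 𝒰 → Λ → (𝒪_{k'}/p^N)(1) → 0` exact).  This file combines `LubinTateColemanRelativeExactTwo` (image of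
`β ↦ r_β`) with `LubinTateColemanRelativeCoordKernelTwo` (injectivity on principal units) in de Shalit's own currency — norm-coherent
units `β` along `E·K_π^{m+1}` with `β_0 ≡ 1 (mod 𝔪)` (`f = πX + X²`, `|𝓀_F| = 2`, `π = 2u` with `u ∈ 𝒪_F^×`, `π ≡ m₁ (mod π²)` for
some `m₁ ∈ ℕ` — all automatic for `F = ℚ₂`; `E ⊆ F^{nr}` finite Galois, Frobenius `φ`):

* `norm_val_zero_ofSeries_sub_one_lt` — `ofSeries G` is principal when `G(0) ≡ 1 (mod π)`;
* ★★★ `exists_principal_relUnitCoordTwo_eq` — **every `r ∈ 𝒪_E⟦Y⟧` with `r(0) = c − u·φ(c)` is `r_β` for a PRINCIPAL `β`**;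
* ★★★ `existsUnique_principal_relUnitCoordTwo_eq` (characteristic `0`, `c ↦ c − u·φ(c)` injective on `𝒪_E` — de Shalit's `N < ∞`):
  **that principal `β` is unique** — the exact sequence `0 → 𝒰¹(E·K_π^∞) → 𝒪_E⟦Y⟧ → 𝒪_E/(1 − uφ)𝒪_E → 0` of Theorem I.3.7 over `k'` in
  power-series currency (the cokernel `𝒪_E/(1−uφ)𝒪_E` is de Shalit's `(𝒪_{k'}/p^N)(1)`).

Everything PROVED (0 sorry).

## References

* E. de Shalit, *Iwasawa theory of elliptic curves with complex multiplication* (1987), Ch. I §3.3, §3.7 Theorem. [deShalit1987]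
-/

noncomputable section

open scoped PowerSeries.WithPiTopology

namespace Literature.NumberTheory.GaloisRepresentations

section RelativeExactPrincipalTwo

open GaloisRepresentations.IsNonarchimedeanLocalField LubinTate ValuativeRel Field

variable {F : Type} [Field F] [ValuativeRel F] [TopologicalSpace F] [IsNonarchimedeanLocalField F]

attribute [local instance] ltNormUniformSpace ltNormIsUniformAddGroup rk1 nF nE fintypeResidueField

variable {π : 𝒪[F]} (hπ : (valuation F).IsUniformizer (π : F))
variable (E : IntermediateField F (AlgebraicClosure F)) [FiniteDimensional F E]


/-- **`‖G^ι(y) − ι G(0)‖ ≤ ‖y‖`** for `G ∈ 𝒪_E⟦X⟧`, `E ≤ E'`, `y ∈ 𝔪_{E'}`. [cite: deShalit1987, Ch. I §2.2] -/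
theorem norm_evS_map_sub_constantCoeff_le {E' : IntermediateField F (AlgebraicClosure F)} [FiniteDimensional F E']
    (h : E ≤ E') (G : PowerSeries (unitBall E)) (y : (maxNilIdeal F E').toIdeal) :
    ‖((evS (maxNilIdeal F E') y (PowerSeries.map (inclUnitBall (F := F) h : unitBall E →+* unitBall E') G) : unitBall E') : E') -
        ((inclUnitBall (F := F) h (PowerSeries.constantCoeff G) : unitBall E') : E')‖ ≤ ‖((y : unitBall E') : E')‖ := by
  have hy : ‖((y : unitBall E') : E')‖ < 1 := y.2
  have h1 : ‖((evS (maxNilIdeal F E') y (PowerSeries.map (inclUnitBall (F := F) h : unitBall E →+* unitBall E')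
      (G - PowerSeries.C (PowerSeries.constantCoeff G))) : unitBall E') : E')‖ ≤ ‖((y : unitBall E') : E')‖ := by
    change ‖((PowerSeries.aeval (isTopologicallyNilpotent_of_norm_lt_one E' hy)
      (PowerSeries.map (inclUnitBall (F := F) h : unitBall E →+* unitBall E')
        (G - PowerSeries.C (PowerSeries.constantCoeff G))) : unitBall E') : E')‖ ≤ _
    refine norm_aeval_le_of_coeff_le (K := 1) _ hy (norm_nonneg _) (fun k hk => ?_) (by rw [pow_one])
    have hk0 : k = 0 := by omega
    subst hk0
    rw [PowerSeries.coeff_map, map_sub, PowerSeries.coeff_zero_eq_constantCoeff, PowerSeries.constantCoeff_C, sub_self,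
      map_zero, ZeroMemClass.coe_zero, norm_zero]
    exact norm_nonneg _
  rwa [map_sub, PowerSeries.map_C, map_sub, evS_C, AddSubgroupClass.coe_sub] at h1

variable [Normal F E] [IsGalois F E] (hq : residueFieldCard F = 2) (hE : E ≤ maxUnramified F)
  {σ₀ : absoluteGaloisGroup F} (hσ₀ : IsAbsArithFrob σ₀)

set_option maxHeartbeats 800000 in
/-- **`ofSeries G` is a principal unit when `G(0) ≡ 1 (mod π)`**: `‖(ofSeries G)_0 − 1‖ < 1` (its value is
`(φ⁻¹G)^ι(ω_1) ≡ φ⁻¹(G(0)) ≡ 1` modulo `𝔪`). [cite: deShalit1987, Ch. I §3.3] -/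
theorem norm_val_zero_ofSeries_sub_one_lt (G : PowerSeries (unitBall E))
    (hG : relNormTwo hπ E hq G = PowerSeries.map (frobUnitBall E σ₀ : unitBall E →+* unitBall E) G)
    (hG0 : IsUnit (PowerSeries.constantCoeff G))
    (hG1 : PowerSeries.constantCoeff G - 1 ∈ Ideal.span {algebraMap 𝒪[F] (unitBall E) π}) :
    ‖(((RelNormCoherentUnits.ofSeries hπ E hq hE G hG hG0).val 0 :
        unitBall (E ⊔ ltField π 0 : IntermediateField F (AlgebraicClosure F))) :
        (E ⊔ ltField π 0 : IntermediateField F (AlgebraicClosure F))) - 1‖ < 1 := by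
  -- the value and the constant term `φ⁻¹(G(0))`
  have hv : (RelNormCoherentUnits.ofSeries hπ E hq hE G hG hG0).val 0 =
      evS (maxNilIdeal F (E ⊔ ltField π 0 : IntermediateField F (AlgebraicClosure F)))
        (inclPt (le_sup_right : ltField π 0 ≤ E ⊔ ltField π 0) (cohPt hπ 0))
        (PowerSeries.map (inclUnitBall (F := F) (le_sup_left : E ≤ E ⊔ ltField π 0) :
          unitBall E →+* unitBall (E ⊔ ltField π 0 : IntermediateField F (AlgebraicClosure F)))
          (PowerSeries.map ((frobUnitBall E σ₀).symm : unitBall E →+* unitBall E) G)) := rfl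
  have hc : PowerSeries.constantCoeff (PowerSeries.map ((frobUnitBall E σ₀).symm : unitBall E →+* unitBall E) G) =
      ((frobUnitBall E σ₀).symm : unitBall E →+* unitBall E) (PowerSeries.constantCoeff G) := by
    rw [← PowerSeries.coeff_zero_eq_constantCoeff_apply, PowerSeries.coeff_map, PowerSeries.coeff_zero_eq_constantCoeff_apply]
  -- `‖φ⁻¹(G(0)) − 1‖ < 1`
  have hc1 : ‖((((frobUnitBall E σ₀).symm : unitBall E →+* unitBall E) (PowerSeries.constantCoeff G) - 1 : unitBall E) : E)‖ < 1 := by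
    have e : ((frobUnitBall E σ₀).symm : unitBall E →+* unitBall E) (PowerSeries.constantCoeff G) - 1 =
        ((frobUnitBall E σ₀).symm : unitBall E →+* unitBall E) (PowerSeries.constantCoeff G - 1) := by
      rw [map_sub (((frobUnitBall E σ₀).symm : unitBall E →+* unitBall E)), map_one]
    rw [e]
    have hn : ‖(((((frobUnitBall E σ₀).symm : unitBall E →+* unitBall E) (PowerSeries.constantCoeff G - 1)) : unitBall E) : E)‖ =
        ‖((PowerSeries.constantCoeff G - 1 : unitBall E) : E)‖ :=
      norm_unitBallEquiv E ((absoluteGaloisGroup.toAlgEquiv F σ₀).restrictNormal E).symm _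
    rw [hn]
    obtain ⟨c, hcc⟩ := Ideal.mem_span_singleton'.mp hG1
    rw [← hcc, Subring.coe_mul, norm_mul]
    calc ‖((c : unitBall E) : E)‖ * ‖((algebraMap 𝒪[F] (unitBall E) π : unitBall E) : E)‖
        ≤ 1 * ‖((algebraMap 𝒪[F] (unitBall E) π : unitBall E) : E)‖ :=
          mul_le_mul_of_nonneg_right ((mem_unitBall_iff E).mp c.2) (norm_nonneg _)
      _ < 1 := by rw [one_mul]; exact norm_algebraMap_pi_lt_one hπ E
  -- ultrametric combination
  have hy : ‖((inclPt (le_sup_right : ltField π 0 ≤ E ⊔ ltField π 0) (cohPt hπ 0) :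
      unitBall (E ⊔ ltField π 0 : IntermediateField F (AlgebraicClosure F))) :
      (E ⊔ ltField π 0 : IntermediateField F (AlgebraicClosure F)))‖ < 1 :=
    (inclPt (le_sup_right : ltField π 0 ≤ E ⊔ ltField π 0) (cohPt hπ 0)).2
  have h1 := norm_evS_map_sub_constantCoeff_le E (le_sup_left : E ≤ E ⊔ ltField π 0)
    (PowerSeries.map ((frobUnitBall E σ₀).symm : unitBall E →+* unitBall E) G)
    (inclPt (le_sup_right : ltField π 0 ≤ E ⊔ ltField π 0) (cohPt hπ 0))
  rw [hc] at h1
  have h2 : ‖((inclUnitBall (F := F) (le_sup_left : E ≤ E ⊔ ltField π 0)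
      (((frobUnitBall E σ₀).symm : unitBall E →+* unitBall E) (PowerSeries.constantCoeff G)) :
      unitBall (E ⊔ ltField π 0 : IntermediateField F (AlgebraicClosure F))) :
      (E ⊔ ltField π 0 : IntermediateField F (AlgebraicClosure F))) - 1‖ < 1 := by
    have e : ((inclUnitBall (F := F) (le_sup_left : E ≤ E ⊔ ltField π 0)
        (((frobUnitBall E σ₀).symm : unitBall E →+* unitBall E) (PowerSeries.constantCoeff G)) :
        unitBall (E ⊔ ltField π 0 : IntermediateField F (AlgebraicClosure F))) :
        (E ⊔ ltField π 0 : IntermediateField F (AlgebraicClosure F))) - 1 =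
        ((inclUnitBall (F := F) (le_sup_left : E ≤ E ⊔ ltField π 0)
          (((frobUnitBall E σ₀).symm : unitBall E →+* unitBall E) (PowerSeries.constantCoeff G) - 1) :
          unitBall (E ⊔ ltField π 0 : IntermediateField F (AlgebraicClosure F))) :
          (E ⊔ ltField π 0 : IntermediateField F (AlgebraicClosure F))) := by
      rw [map_sub (inclUnitBall (F := F) (le_sup_left : E ≤ E ⊔ ltField π 0)), map_one, AddSubgroupClass.coe_sub, OneMemClass.coe_one]
    rw [e, norm_inclUnitBall]
    exact hc1
  rw [hv]
  have e3 : ((evS (maxNilIdeal F (E ⊔ ltField π 0 : IntermediateField F (AlgebraicClosure F)))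
        (inclPt (le_sup_right : ltField π 0 ≤ E ⊔ ltField π 0) (cohPt hπ 0))
        (PowerSeries.map (inclUnitBall (F := F) (le_sup_left : E ≤ E ⊔ ltField π 0) :
          unitBall E →+* unitBall (E ⊔ ltField π 0 : IntermediateField F (AlgebraicClosure F)))
          (PowerSeries.map ((frobUnitBall E σ₀).symm : unitBall E →+* unitBall E) G)) :
        unitBall (E ⊔ ltField π 0 : IntermediateField F (AlgebraicClosure F))) :
        (E ⊔ ltField π 0 : IntermediateField F (AlgebraicClosure F))) - 1 =
      (((evS (maxNilIdeal F (E ⊔ ltField π 0 : IntermediateField F (AlgebraicClosure F)))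
          (inclPt (le_sup_right : ltField π 0 ≤ E ⊔ ltField π 0) (cohPt hπ 0))
          (PowerSeries.map (inclUnitBall (F := F) (le_sup_left : E ≤ E ⊔ ltField π 0) :
            unitBall E →+* unitBall (E ⊔ ltField π 0 : IntermediateField F (AlgebraicClosure F)))
            (PowerSeries.map ((frobUnitBall E σ₀).symm : unitBall E →+* unitBall E) G)) :
          unitBall (E ⊔ ltField π 0 : IntermediateField F (AlgebraicClosure F))) :
          (E ⊔ ltField π 0 : IntermediateField F (AlgebraicClosure F))) -
        ((inclUnitBall (F := F) (le_sup_left : E ≤ E ⊔ ltField π 0)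
          (((frobUnitBall E σ₀).symm : unitBall E →+* unitBall E) (PowerSeries.constantCoeff G)) :
          unitBall (E ⊔ ltField π 0 : IntermediateField F (AlgebraicClosure F))) :
          (E ⊔ ltField π 0 : IntermediateField F (AlgebraicClosure F)))) +
      (((inclUnitBall (F := F) (le_sup_left : E ≤ E ⊔ ltField π 0)
          (((frobUnitBall E σ₀).symm : unitBall E →+* unitBall E) (PowerSeries.constantCoeff G)) :
          unitBall (E ⊔ ltField π 0 : IntermediateField F (AlgebraicClosure F))) :
          (E ⊔ ltField π 0 : IntermediateField F (AlgebraicClosure F))) - 1) := by ring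
  rw [e3]
  exact lt_of_le_of_lt (IsUltrametricDist.norm_add_le_max _ _) (max_lt (lt_of_le_of_lt h1 hy) h2)

set_option maxHeartbeats 800000 in
/-- ★★★ **Theorem I.3.7 over `k'` for principal units, surjectivity**: every `r ∈ 𝒪_E⟦Y⟧` with `r(0) = c − u·φ(c)` for some
`c ∈ 𝒪_E` is `r_β` for a PRINCIPAL norm-coherent unit `β` (`β_0 ≡ 1 (mod 𝔪)`): the unit `G` with `δ_E G = h`, `𝒩_E G = G^φ`
produced by `exists_relNormTwo_eq_map_relLogDeriv_eq` is principal. [cite: deShalit1987, Ch. I §3.7 Theorem] -/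
theorem exists_principal_relUnitCoordTwo_eq (u : (LTCoeff F)ˣ) (hu : LTCoeff.of F π = residueFieldCard F * u)
    (hm : ∃ m₁ : ℕ, LTCoeff.of F π ^ 2 ∣ LTCoeff.of F π - m₁) (r : PowerSeries (unitBall E)) (c : unitBall E)
    (hr : PowerSeries.constantCoeff r =
      c - algebraMap (LTCoeff F) (unitBall E) u * (frobUnitBall E σ₀ : unitBall E →+* unitBall E) c) :
    ∃ β : RelNormCoherentUnits hπ E,
      ‖((β.val 0 : unitBall (E ⊔ ltField π 0 : IntermediateField F (AlgebraicClosure F))) :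
        (E ⊔ ltField π 0 : IntermediateField F (AlgebraicClosure F))) - 1‖ < 1 ∧
      relUnitCoordTwo hπ E hq hE hσ₀ u hu β = r := by
  obtain ⟨m₁, hm₁⟩ := hm
  have ht := two_eq_of_mul_inv hq u hu
  obtain ⟨g, hgdef⟩ : ∃ g : PowerSeries (unitBall E),
      g = (1 + PowerSeries.C (algebraMap (LTCoeff F) (unitBall E) (↑u⁻¹ : LTCoeff F)) * PowerSeries.X) *
        PowerSeries.subst ((ltSer F π).map (algebraMap (LTCoeff F) (unitBall E))) r := ⟨_, rfl⟩
  have hSg : relTraceTwo hπ E hq g = 0 := (relTraceTwo_eq_zero_iff hπ E hq ht g).mpr ⟨r, hgdef⟩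
  have hg0 : PowerSeries.constantCoeff g =
      c - algebraMap (LTCoeff F) (unitBall E) u * (frobUnitBall E σ₀ : unitBall E →+* unitBall E) c := by
    rw [hgdef, map_mul (PowerSeries.constantCoeff (R := unitBall E)), map_add (PowerSeries.constantCoeff (R := unitBall E)),
      map_one, map_mul (PowerSeries.constantCoeff (R := unitBall E)), PowerSeries.constantCoeff_C, PowerSeries.constantCoeff_X,
      mul_zero, add_zero, one_mul, constantCoeff_subst_map_ltSer, hr]
  obtain ⟨h, -, hht, hhS⟩ := exists_twistedTilde_eq_of_constantCoeff_eq hπ E hq hu (frobUnitBall_algebraMap_pi E σ₀) hSg hg0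
  obtain ⟨G, hGN, hG1, hGδ⟩ := exists_relNormTwo_eq_map_relLogDeriv_eq hπ E hq u hu hm₁ (frobUnitBall E σ₀)
    (frobUnitBall_algebraMap_LTCoeff E σ₀) (frobUnitBall_sub_sq_mem hπ E hq hE hσ₀) hhS
  have hG0 : IsUnit (PowerSeries.constantCoeff (G : PowerSeries (unitBall E))) := PowerSeries.isUnit_constantCoeff _ G.isUnit
  refine ⟨RelNormCoherentUnits.ofSeries hπ E hq hE _ hGN hG0, norm_val_zero_ofSeries_sub_one_lt hπ E hq hE _ hGN hG0 hG1, ?_⟩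
  have hgβ := relColemanSeries_ofSeries hπ E hq hE hσ₀ (G : PowerSeries (unitBall E)) hGN hG0
  have hδβ : relLogDerivSeries hπ E hq hE hσ₀ (RelNormCoherentUnits.ofSeries hπ E hq hE _ hGN hG0) = h := by
    rw [relLogDerivSeries, ← hGδ]
    congr 1
    exact Units.ext (by rw [IsUnit.unit_spec, hgβ])
  symm
  refine eq_relUnitCoordTwo hπ E hq hE hσ₀ u hu _ ?_
  rw [relTildeSeries, hδβ, hht, hgdef]

/-- ★★★ **Theorem I.3.7 over `k' = E` for principal units: EXISTENCE AND UNIQUENESS** (characteristic `0`; `q = 2`, `π = 2u`,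
`π ≡ m₁ (mod π²)`; `E ⊆ F^{nr}` finite Galois with Frobenius `φ`; the anomaly map `c ↦ c − u·φ(c)` injective on `𝒪_E`, i.e.
de Shalit's `N < ∞`): for every `r ∈ 𝒪_E⟦Y⟧` with `r(0) = c − u·φ(c)` there is EXACTLY ONE principal norm-coherent unit `β` along
`E·K_π^∞` with `r_β = r` — together with `constantCoeff_relUnitCoordTwo` (`r_β(0) ∈ (1 − uφ)𝒪_E` always) this is the exact
sequence `0 → 𝒰¹ → 𝒪_E⟦Y⟧ → 𝒪_E/(1 − uφ)𝒪_E → 0`. [cite: deShalit1987, Ch. I §3.7 Theorem] -/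
theorem existsUnique_principal_relUnitCoordTwo_eq [CharZero F] (u : (LTCoeff F)ˣ) (hu : LTCoeff.of F π = residueFieldCard F * u)
    (hm : ∃ m₁ : ℕ, LTCoeff.of F π ^ 2 ∣ LTCoeff.of F π - m₁)
    (hinj : ∀ c : unitBall E, c = algebraMap (LTCoeff F) (unitBall E) u * (frobUnitBall E σ₀ : unitBall E →+* unitBall E) c → c = 0)
    (r : PowerSeries (unitBall E)) (c : unitBall E)
    (hr : PowerSeries.constantCoeff r =
      c - algebraMap (LTCoeff F) (unitBall E) u * (frobUnitBall E σ₀ : unitBall E →+* unitBall E) c) :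
    ∃! β : RelNormCoherentUnits hπ E,
      ‖((β.val 0 : unitBall (E ⊔ ltField π 0 : IntermediateField F (AlgebraicClosure F))) :
        (E ⊔ ltField π 0 : IntermediateField F (AlgebraicClosure F))) - 1‖ < 1 ∧
      relUnitCoordTwo hπ E hq hE hσ₀ u hu β = r := by
  obtain ⟨β, hβ1, hβ⟩ := exists_principal_relUnitCoordTwo_eq hπ E hq hE hσ₀ u hu hm r c hr
  refine ⟨β, ⟨hβ1, hβ⟩, fun β' hβ' => ?_⟩
  exact (eq_of_relUnitCoordTwo_eq_of_norm_sub_one_lt hπ E hq hE hσ₀ u hu hinj hβ1 hβ'.1 (hβ.trans hβ'.2.symm)).symm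

end RelativeExactPrincipalTwo

end Literature.NumberTheory.GaloisRepresentations
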